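import Literature.NumberTheory.PAdicHodge.FontaineThetaKernel
import Literature.NumberTheory.PAdicHodge.FontaineThetaGalois
import Literature.NumberTheory.PAdicHodge.CyclotomicTower
import Mathlib.NumberTheory.Padics.RingHoms
import Mathlib.RingTheory.WittVector.Compare
import HarnessLib

/-!
# The element `ε = (1, ζ_p, ζ_{p²}, …)` of `𝒪_{ℂ_F}♭`, `[ε] ∈ 𝔸_inf(F)`, and the Galois action

For a nonarchimedean local field `F` of characteristic `0` and residue characteristic `p`:

* `epsRaw p n ∈ F̄` : a compatible system of primitive `pⁿ`-th roots of unity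
  (`epsRaw p (n+1)^p = epsRaw p n`, `epsRaw p 0 = 1`, `epsRaw p 1 = ζ_p`), `epsC p n ∈ 𝒪_{ℂ_F}`;
* `eps : 𝒪_{ℂ_F}♭` : Fontaine's `ε`, with `ε♯ = 1` (`untilt_eps`), and more generally
  `epsPow a = ε^a` for `a ∈ ℤ_p` (componentwise `ζ_{pⁿ}^{a mod pⁿ}`), a homomorphism
  `ℤ_p → (𝒪_{ℂ_F}♭)ˣ` in additive/multiplicative notation (`epsPow_add`, `epsPow_natCast`);
* **Galois action**: `σ♭(ε) = ε^{χ(σ)}` (`galTilt_eps`) where `χ` is the `p`-adic cyclotomic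
  character of `Γ_F` (tree `GaloisRep.cyclotomicCharacter`), hence
  `𝕎(σ♭)[ε] = [ε^{χ(σ)}]` (`galAinf_teichmuller_eps`);
* `uAinf = [ε] − 1 ∈ ker θ` (`xi_dvd_uAinf`), and `θ([ε^a]) = 1` (`fontaineTheta_teichmuller_epsPow`).

These are the inputs for `t = log [ε]` / the Tate twist on `gr¹ B_dR` (Fontaine 1994, Exp. II
§1.5.4; Fontaine–Ouyang §5.1.2).

## References
* [FontaineAsterisque223III] J.-M. Fontaine, *Le corps des périodes p-adiques*, Astérisque 223
  (1994), Exp. II, §1.2.2, §1.5.4.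
* [FontaineOuyang2022] J.-M. Fontaine, Y. Ouyang, *Theory of p-adic Galois representations*
  (book draft), §4.3, §5.1.2.
-/

noncomputable section

open ValuativeRel Field Ideal WittVector UniformSpace

namespace Literature.NumberTheory.PAdicHodge

open Literature.NumberTheory.GaloisRepresentations
open Literature.NumberTheory.GaloisRepresentations.IsNonarchimedeanLocalField

variable {F : Type} [Field F] [ValuativeRel F] [TopologicalSpace F] [IsNonarchimedeanLocalField F]
  [CharZero F] {p : ℕ} [Fact p.Prime]

/-! ### Powers modulo the order -/

omit [ValuativeRel F] [TopologicalSpace F] [IsNonarchimedeanLocalField F] [CharZero F] [Fact p.Prime] in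
/-- If `x^k = 1` then `x^a` only depends on `a mod k`. [folklore] -/
theorem pow_eq_pow_mod_of_pow_eq_one {M : Type*} [Monoid M] {x : M} {k : ℕ} (hx : x ^ k = 1) (a : ℕ) :
    x ^ a = x ^ (a % k) := by
  conv_lhs => rw [← Nat.mod_add_div a k, pow_add, pow_mul, hx, one_pow, mul_one]

omit [ValuativeRel F] [TopologicalSpace F] [IsNonarchimedeanLocalField F] [CharZero F] [Fact p.Prime] in
/-- If `x^k = 1` and `a ≡ b mod k` then `x^a = x^b`. [folklore] -/
theorem pow_eq_pow_of_modEq {M : Type*} [Monoid M] {x : M} {k a b : ℕ} (hx : x ^ k = 1) (h : a ≡ b [MOD k]) :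
    x ^ a = x ^ b := by
  rw [pow_eq_pow_mod_of_pow_eq_one hx a, pow_eq_pow_mod_of_pow_eq_one hx b, h]

/-! ### Compatible primitive `pⁿ`-th roots of unity -/

variable (p) in
/-- **A compatible system `(ζ_{pⁿ})_n` of primitive `pⁿ`-th roots of unity in `F̄`**:
`epsRaw p 0 = 1`, `epsRaw p 1 = ζ_p` (`CyclotomicTower.zeta F p 1`), and `epsRaw p (n+2)` a chosen
`p`-th root of `epsRaw p (n+1)` (`F̄` algebraically closed). [cite: FontaineOuyang2022, §4.3] -/
def epsRaw : ℕ → NormedAlgClosure F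
  | 0 => 1
  | 1 => CyclotomicTower.zeta F p 1
  | n + 2 => Classical.choose (IsAlgClosed.exists_pow_nat_eq (epsRaw (n + 1)) (Fact.out : p.Prime).pos)

/-- `epsRaw p 0 = 1`. [folklore] -/
@[simp] theorem epsRaw_zero : (epsRaw p 0 : NormedAlgClosure F) = 1 := rfl

/-- `epsRaw p 1 = ζ_p`. [folklore] -/
theorem epsRaw_one : (epsRaw p 1 : NormedAlgClosure F) = CyclotomicTower.zeta F p 1 := rfl

/-- Compatibility: `epsRaw p (n+1) ^ p = epsRaw p n`. [folklore] -/
theorem epsRaw_succ_pow : ∀ n : ℕ, (epsRaw p (n + 1) : NormedAlgClosure F) ^ p = epsRaw p n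
  | 0 => by
    rw [epsRaw_one, epsRaw_zero]
    have h := (CyclotomicTower.zeta_spec F p 1).pow_eq_one
    rwa [pow_one] at h
  | n + 1 => Classical.choose_spec (IsAlgClosed.exists_pow_nat_eq (epsRaw p (n + 1)) (Fact.out : p.Prime).pos)

/-- `epsRaw p n ^ pⁿ = 1`. [folklore] -/
theorem epsRaw_pow (n : ℕ) : (epsRaw p n : NormedAlgClosure F) ^ p ^ n = 1 := by
  induction n with
  | zero => rw [pow_zero, pow_one, epsRaw_zero]
  | succ n ih => rw [pow_succ', pow_mul, epsRaw_succ_pow, ih]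

/-- **`epsRaw p n` is a primitive `pⁿ`-th root of unity.** [folklore] -/
theorem isPrimitiveRoot_epsRaw : ∀ n : ℕ, IsPrimitiveRoot (epsRaw p n : NormedAlgClosure F) (p ^ n)
  | 0 => by rw [pow_zero, epsRaw_zero]; exact IsPrimitiveRoot.one
  | 1 => by rw [pow_one, epsRaw_one]; simpa using CyclotomicTower.zeta_spec F p 1
  | n + 2 => by
    have hp := (Fact.out : p.Prime)
    haveI : Fact p.Prime := ⟨hp⟩
    have ih := isPrimitiveRoot_epsRaw (n + 1)
    have hnot : ¬ (epsRaw p (n + 2) : NormedAlgClosure F) ^ p ^ (n + 1) = 1 := by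
      intro h
      rw [pow_succ', pow_mul, epsRaw_succ_pow] at h
      -- `ζ_{p^{n+1}} ^ {p^n} = 1` contradicts primitivity
      have h1 := ih.dvd_of_pow_eq_one _ h
      have h2 : p ^ n < p ^ (n + 1) := Nat.pow_lt_pow_right hp.one_lt (Nat.lt_succ_self n)
      exact absurd (Nat.le_of_dvd (pow_pos hp.pos n) h1) (not_le.2 h2)
    have hord := orderOf_eq_prime_pow hnot (epsRaw_pow (n + 2))
    rw [← hord]; exact IsPrimitiveRoot.orderOf _

/-- `‖epsRaw p n‖ = 1`. [folklore] -/
theorem norm_epsRaw (n : ℕ) : ‖(epsRaw p n : NormedAlgClosure F)‖ = 1 :=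
  CyclotomicTower.norm_eq_one_of_pow_eq_one (epsRaw_pow n)

variable (p) in
/-- **`ζ_{pⁿ} ∈ 𝒪_{ℂ_F}`.** [folklore] -/
def epsC (n : ℕ) : integerC F :=
  ⟨((epsRaw p n : NormedAlgClosure F) : CompletedAlgClosure F), by
    rw [mem_integerC_iff, Completion.norm_coe, norm_epsRaw]⟩

/-- `epsC p (n+1)^p = epsC p n`. [folklore] -/
theorem epsC_succ_pow (n : ℕ) : (epsC p (n + 1) : integerC F) ^ p = epsC p n := by
  refine Subtype.ext ?_
  rw [SubmonoidClass.coe_pow]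
  change (Completion.coeRingHom : NormedAlgClosure F →+* CompletedAlgClosure F) (epsRaw p (n + 1)) ^ p =
    (Completion.coeRingHom : NormedAlgClosure F →+* CompletedAlgClosure F) (epsRaw p n)
  rw [← map_pow, epsRaw_succ_pow]

/-- `epsC p n ^ pⁿ = 1`. [folklore] -/
theorem epsC_pow (n : ℕ) : (epsC p n : integerC F) ^ p ^ n = 1 := by
  refine Subtype.ext ?_
  rw [SubmonoidClass.coe_pow]
  change (Completion.coeRingHom : NormedAlgClosure F →+* CompletedAlgClosure F) (epsRaw p n) ^ p ^ n = 1
  rw [← map_pow, epsRaw_pow, map_one]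

/-- `epsC p 0 = 1`. [folklore] -/
@[simp] theorem epsC_zero : (epsC p 0 : integerC F) = 1 := by
  rw [← epsC_pow (p := p) (F := F) 0, pow_zero, pow_one]

/-- **Galois acts on `ζ_{pⁿ}` through the cyclotomic character**: `σ ζ_{pⁿ} = ζ_{pⁿ}^{χ(σ) mod pⁿ}`.
[cite: FontaineOuyang2022, §4.3] -/
theorem galInt_epsC (σ : absoluteGaloisGroup F) (n : ℕ) :
    galInt σ (epsC p n) = epsC p n ^ ((GaloisRep.cyclotomicCharacter F p σ).val.toZModPow n).val := by
  haveI : NeZero (p : F) := ⟨Nat.cast_ne_zero.2 (Fact.out : p.Prime).ne_zero⟩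
  refine Subtype.ext ?_
  rw [coe_galInt, SubmonoidClass.coe_pow]
  change σ • (((epsRaw p n : NormedAlgClosure F)) : CompletedAlgClosure F) =
    (((epsRaw p n : NormedAlgClosure F)) : CompletedAlgClosure F) ^ ((GaloisRep.cyclotomicCharacter F p σ).val.toZModPow n).val
  rw [CompletedAlgClosure.smul_coe]
  have h := GaloisRep.cyclotomicCharacter_spec F p σ (epsRaw p n : NormedAlgClosure F) (epsRaw_pow n)
  change ((σ • epsRaw p n : NormedAlgClosure F) : CompletedAlgClosure F) = _
  rw [show (σ • epsRaw p n : NormedAlgClosure F) = epsRaw p n ^ ((GaloisRep.cyclotomicCharacter F p σ).val.toZModPow n).val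
    from h]
  exact map_pow (Completion.coeRingHom : NormedAlgClosure F →+* CompletedAlgClosure F) _ _

section Tilt

variable [Fact (¬ IsUnit (p : integerC F))]

/-! ### `ε` and `ε^a` in the tilt -/

/-- **Fontaine's `ε = (ζ_{pⁿ} mod p)_n ∈ 𝒪_{ℂ_F}♭`.** [cite: FontaineAsterisque223III, Exp. II §1.2.2]
[cite: FontaineOuyang2022, §4.3] -/
def eps : PreTilt (integerC F) p :=
  ⟨fun n => Ideal.Quotient.mk _ (epsC p n), fun n => by rw [← map_pow, epsC_succ_pow]⟩

/-- Coefficients of `ε`. [folklore] -/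
@[simp] theorem coeff_eps (n : ℕ) :
    PreTilt.coeff n (eps : PreTilt (integerC F) p) = Ideal.Quotient.mk _ (epsC p n) := rfl

/-- The exponents `a mod pⁿ` are compatible: `(a mod p^{n+1}) ≡ (a mod pⁿ) [MOD pⁿ]`. [folklore] -/
theorem toZModPow_val_modEq (a : ℤ_[p]) {m n : ℕ} (h : m ≤ n) :
    (PadicInt.toZModPow n a).val ≡ (PadicInt.toZModPow m a).val [MOD p ^ m] := by
  haveI : NeZero (p ^ n) := ⟨pow_ne_zero _ (Fact.out : p.Prime).ne_zero⟩
  have h1 := PadicInt.cast_toZModPow m n h a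
  rw [ZMod.cast_eq_val] at h1
  -- `((toZModPow n a).val : ZMod (p^m)) = toZModPow m a`
  have h2 : (PadicInt.toZModPow m a).val = (PadicInt.toZModPow n a).val % p ^ m := by
    rw [← h1, ZMod.val_natCast]
  rw [h2]
  exact (Nat.mod_modEq _ _).symm

/-- **`ε^a ∈ 𝒪_{ℂ_F}♭` for `a ∈ ℤ_p`**: componentwise `ζ_{pⁿ}^{a mod pⁿ}`. [cite: FontaineOuyang2022, §5.1.2] -/
def epsPow (a : ℤ_[p]) : PreTilt (integerC F) p :=
  ⟨fun n => Ideal.Quotient.mk _ (epsC p n ^ (PadicInt.toZModPow n a).val), fun n => by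
    rw [← map_pow, ← pow_mul, mul_comm, pow_mul, epsC_succ_pow,
      pow_eq_pow_of_modEq (epsC_pow n) (toZModPow_val_modEq a (Nat.le_succ n))]⟩

/-- Coefficients of `ε^a`. [folklore] -/
@[simp] theorem coeff_epsPow (a : ℤ_[p]) (n : ℕ) :
    PreTilt.coeff n (epsPow a : PreTilt (integerC F) p) =
      Ideal.Quotient.mk _ (epsC p n ^ (PadicInt.toZModPow n a).val) := rfl

/-- `ε^(a+b) = ε^a ε^b`. [folklore] -/
theorem epsPow_add (a b : ℤ_[p]) : (epsPow (a + b) : PreTilt (integerC F) p) = epsPow a * epsPow b := by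
  refine Perfection.ext fun n => ?_
  haveI : NeZero (p ^ n) := ⟨pow_ne_zero _ (Fact.out : p.Prime).ne_zero⟩
  change PreTilt.coeff n (epsPow (a + b)) = PreTilt.coeff n (epsPow a * epsPow b)
  rw [map_mul, coeff_epsPow, coeff_epsPow, coeff_epsPow, ← map_mul, ← pow_add, map_add, ZMod.val_add,
    ← pow_eq_pow_mod_of_pow_eq_one (epsC_pow n)]

/-- `ε^0 = 1`. [folklore] -/
theorem epsPow_zero : (epsPow 0 : PreTilt (integerC F) p) = 1 := by
  refine Perfection.ext fun n => ?_
  change PreTilt.coeff n (epsPow 0) = PreTilt.coeff n 1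
  rw [coeff_epsPow, map_zero, ZMod.val_zero, pow_zero, map_one, map_one]

/-- `ε^N = ε^N` for `N : ℕ`. [folklore] -/
theorem epsPow_natCast (N : ℕ) : (epsPow (N : ℤ_[p]) : PreTilt (integerC F) p) = eps ^ N := by
  refine Perfection.ext fun n => ?_
  change PreTilt.coeff n (epsPow (N : ℤ_[p])) = PreTilt.coeff n (eps ^ N)
  rw [map_pow, coeff_epsPow, coeff_eps, ← map_pow, map_natCast, ZMod.val_natCast,
    ← pow_eq_pow_mod_of_pow_eq_one (epsC_pow n)]

/-- `ε^1 = ε`. [folklore] -/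
theorem epsPow_one : (epsPow 1 : PreTilt (integerC F) p) = eps := by
  have h := epsPow_natCast (F := F) (p := p) 1
  rwa [Nat.cast_one, pow_one] at h

/-- `ε^(pᵐ b) = (ε^b)^(pᵐ)`. [folklore] -/
theorem epsPow_pow_mul (m : ℕ) (b : ℤ_[p]) :
    (epsPow ((p : ℤ_[p]) ^ m * b) : PreTilt (integerC F) p) = epsPow b ^ p ^ m := by
  refine Perfection.ext fun n => ?_
  haveI : NeZero (p ^ n) := ⟨pow_ne_zero _ (Fact.out : p.Prime).ne_zero⟩
  change PreTilt.coeff n (epsPow ((p : ℤ_[p]) ^ m * b)) = PreTilt.coeff n (epsPow b ^ p ^ m)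
  rw [map_pow, coeff_epsPow, coeff_epsPow, ← map_pow, ← pow_mul]
  congr 1
  refine pow_eq_pow_of_modEq (epsC_pow n) ?_
  rw [map_mul, ZMod.val_mul, map_pow, map_natCast, ← Nat.cast_pow, ZMod.val_natCast]
  refine (Nat.mod_modEq _ _).trans (((Nat.mod_modEq _ _).mul_right _).trans ?_)
  rw [mul_comm]

/-! ### The Galois action on `ε` -/

/-- **`σ♭(ε^a) = ε^{χ(σ) a}`** (`χ` = the `p`-adic cyclotomic character of `Γ_F`).
[cite: FontaineAsterisque223III, Exp. II §1.5.4] [cite: FontaineOuyang2022, §5.1.2] -/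
theorem galTilt_epsPow (σ : absoluteGaloisGroup F) (a : ℤ_[p]) :
    galTilt σ (epsPow a : PreTilt (integerC F) p) =
      epsPow (((GaloisRep.cyclotomicCharacter F p σ : ℤ_[p]ˣ) : ℤ_[p]) * a) := by
  refine Perfection.ext fun n => ?_
  haveI : NeZero (p ^ n) := ⟨pow_ne_zero _ (Fact.out : p.Prime).ne_zero⟩
  change PreTilt.coeff n (galTilt σ (epsPow a)) = PreTilt.coeff n (epsPow _)
  rw [coeff_galTilt, coeff_epsPow, coeff_epsPow, galModP_mk, map_pow, galInt_epsC, ← pow_mul]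
  congr 1
  refine pow_eq_pow_of_modEq (epsC_pow n) ?_
  rw [map_mul, ZMod.val_mul]
  exact (Nat.mod_modEq _ _).symm

/-- **`σ♭(ε) = ε^{χ(σ)}`.** [cite: FontaineAsterisque223III, Exp. II §1.5.4] -/
theorem galTilt_eps (σ : absoluteGaloisGroup F) :
    galTilt σ (eps : PreTilt (integerC F) p) = epsPow ((GaloisRep.cyclotomicCharacter F p σ : ℤ_[p]ˣ) : ℤ_[p]) := by
  rw [← epsPow_one, galTilt_epsPow, mul_one]

/-- **`𝕎(σ♭)[ε^a] = [ε^{χ(σ) a}]`** in `𝔸_inf(F)`. [cite: FontaineAsterisque223III, Exp. II §1.5.4] -/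
theorem galAinf_teichmuller_epsPow (σ : absoluteGaloisGroup F) (a : ℤ_[p]) :
    galAinf σ (teichmuller p (epsPow a : PreTilt (integerC F) p)) =
      teichmuller p (epsPow (((GaloisRep.cyclotomicCharacter F p σ : ℤ_[p]ˣ) : ℤ_[p]) * a)) := by
  rw [galAinf_teichmuller, galTilt_epsPow]

/-- `𝕎(σ♭)[ε] = [ε^{χ(σ)}]`. [cite: FontaineAsterisque223III, Exp. II §1.5.4] -/
theorem galAinf_teichmuller_eps (σ : absoluteGaloisGroup F) :
    galAinf σ (teichmuller p (eps : PreTilt (integerC F) p)) =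
      teichmuller p (epsPow ((GaloisRep.cyclotomicCharacter F p σ : ℤ_[p]ˣ) : ℤ_[p])) := by
  rw [galAinf_teichmuller, galTilt_eps]

/-! ### `𝔸_inf(F)` as a `ℤ_p`-algebra -/

omit [CharZero F] in
/-- **The structure map `ℤ_p = 𝕎(𝔽_p) → 𝕎(𝒪_{ℂ_F}♭) = 𝔸_inf(F)`** (functoriality of Witt vectors
along `𝔽_p → 𝒪_{ℂ_F}♭`, composed with Mathlib's `𝕎(𝔽_p) ≃ ℤ_p`). [cite: FontaineOuyang2022, §4.4] -/
def zpToAinf : ℤ_[p] →+* Ainf (p := p) F :=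
  (WittVector.map (ZMod.castHom (dvd_refl p) (PreTilt (integerC F) p))).comp (WittVector.equiv p).symm.toRingHom

omit [CharZero F] in
/-- `zpToAinf` on naturals. [folklore] -/
theorem zpToAinf_natCast (N : ℕ) : zpToAinf (N : ℤ_[p]) = (N : Ainf (p := p) F) := map_natCast _ _

/-! ### `θ([ε^a]) = 1` and `u = [ε] − 1 ∈ ker θ` -/

variable [IsAdicComplete (Ideal.span {(p : integerC F)}) (integerC F)]

/-- **`(ε^a)♯ = 1`.** [cite: FontaineOuyang2022, §4.3] -/
theorem untilt_epsPow (a : ℤ_[p]) : PreTilt.untilt (epsPow a : PreTilt (integerC F) p) = 1 := by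
  change Perfection.teichmuller p (Ideal.span {(p : integerC F)}) (epsPow a) = _
  refine Perfection.teichmuller_spec fun n => ⟨epsC p n ^ (PadicInt.toZModPow n a).val, rfl, ?_⟩
  rw [← pow_mul, mul_comm, pow_mul, epsC_pow, one_pow]
  exact SModEq.refl (M := integerC F) _

/-- `ε♯ = 1`. [cite: FontaineOuyang2022, §4.3] -/
theorem untilt_eps : PreTilt.untilt (eps : PreTilt (integerC F) p) = 1 := by
  rw [← epsPow_one, untilt_epsPow]

/-- **`θ([ε^a]) = 1`.** [cite: FontaineAsterisque223III, Exp. II §1.5.4] -/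
theorem fontaineTheta_teichmuller_epsPow (a : ℤ_[p]) :
    fontaineTheta (integerC F) p (teichmuller p (epsPow a : PreTilt (integerC F) p)) = 1 := by
  rw [fontaineTheta_teichmuller, untilt_epsPow]

/-- `[ε^a] − 1 ∈ ker θ = (ξ)`. [folklore] -/
theorem xi_dvd_teichmuller_epsPow_sub_one (a : ℤ_[p]) :
    (xi : Ainf (p := p) F) ∣ teichmuller p (epsPow a : PreTilt (integerC F) p) - 1 :=
  xi_dvd_of_fontaineTheta_eq_zero (by rw [map_sub, fontaineTheta_teichmuller_epsPow, map_one, sub_self])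

/-- **`u = [ε] − 1 ∈ 𝔸_inf(F)`**, the argument of Fontaine's `t = log [ε]`. [cite: FontaineAsterisque223III, Exp. II §1.5.4] -/
def uAinf : Ainf (p := p) F := teichmuller p (eps : PreTilt (integerC F) p) - 1

omit [IsAdicComplete (Ideal.span {(p : integerC F)}) (integerC F)] in
/-- Unfolding of `u`. [folklore] -/
theorem uAinf_def : (uAinf : Ainf (p := p) F) = teichmuller p (eps : PreTilt (integerC F) p) - 1 := rfl

/-- **`ξ ∣ u`, i.e. `u = [ε] − 1 ∈ ker θ`** (`θ(u) = ε♯ − 1 = 0`). [cite: FontaineAsterisque223III, Exp. II §1.5.4] -/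
theorem xi_dvd_uAinf : (xi : Ainf (p := p) F) ∣ uAinf :=
  xi_dvd_of_fontaineTheta_eq_zero (by
    rw [uAinf_def, map_sub, fontaineTheta_teichmuller, untilt_eps, map_one, sub_self])

omit [IsAdicComplete (Ideal.span {(p : integerC F)}) (integerC F)] in
/-- **`σ(u) = [ε^{χ(σ)}] − 1`.** [cite: FontaineAsterisque223III, Exp. II §1.5.4] -/
theorem galAinf_uAinf (σ : absoluteGaloisGroup F) :
    galAinf σ (uAinf : Ainf (p := p) F) =
      teichmuller p (epsPow ((GaloisRep.cyclotomicCharacter F p σ : ℤ_[p]ˣ) : ℤ_[p])) - 1 := by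
  rw [uAinf_def, map_sub, galAinf_teichmuller_eps, map_one]

/-! ### Closedness of `(ξᵏ)` for the `p`-adic topology -/

omit [IsAdicComplete (Ideal.span {(p : integerC F)}) (integerC F)] in
/-- `ξᵏ c ∈ pⁿ𝔸_inf ⇒ c ∈ pⁿ𝔸_inf`. [folklore] -/
theorem mem_span_p_pow_of_xi_pow_mul_mem (k n : ℕ) {c : Ainf (p := p) F}
    (h : xi ^ k * c ∈ Ideal.span {((p : Ainf (p := p) F)) ^ n}) : c ∈ Ideal.span {((p : Ainf (p := p) F)) ^ n} := by
  induction k generalizing c with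
  | zero => rwa [pow_zero, one_mul] at h
  | succ k ih => rw [pow_succ', mul_assoc] at h; exact ih (mem_span_p_pow_of_xi_mul_mem n h)

omit [IsAdicComplete (Ideal.span {(p : integerC F)}) (integerC F)] in
/-- **`ξᵏ𝔸_inf` is `p`-adically closed**: if `x ∈ ξᵏ𝔸_inf + pᵐ𝔸_inf` for every `m` then
`x ∈ ξᵏ𝔸_inf` (Cauchy sequence of coefficients, `p`-adic completeness of `𝔸_inf`).
[cite: FontaineOuyang2022, Prop. 4.4.3] -/
theorem mem_span_xi_pow_of_forall (k : ℕ) {x : Ainf (p := p) F}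
    (h : ∀ m : ℕ, ∃ c d : Ainf (p := p) F, x = xi ^ k * c + (p : Ainf (p := p) F) ^ m * d) :
    x ∈ Ideal.span {(xi : Ainf (p := p) F) ^ k} := by
  choose c d hcd using h
  have hx' : ∀ m, x - xi ^ k * c m ∈ Ideal.span {((p : Ainf (p := p) F)) ^ m} := fun m =>
    Ideal.mem_span_singleton'.2 ⟨d m, by rw [hcd m]; ring⟩
  have hcauchy : ∀ {m n : ℕ}, m ≤ n → c m ≡ c n [SMOD (Ideal.span {(p : Ainf (p := p) F)} ^ m • ⊤ :
      Submodule (Ainf (p := p) F) (Ainf (p := p) F))] := by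
    intro m n hmn
    rw [smul_eq_mul, Ideal.mul_top, Ideal.span_singleton_pow, SModEq.sub_mem]
    have h1 : xi ^ k * (c m - c n) ∈ Ideal.span {((p : Ainf (p := p) F)) ^ m} := by
      have : xi ^ k * (c m - c n) = (x - xi ^ k * c n) - (x - xi ^ k * c m) := by ring
      rw [this]
      exact Submodule.sub_mem _ (Ideal.span_singleton_le_span_singleton.2 (pow_dvd_pow _ hmn) (hx' n)) (hx' m)
    exact mem_span_p_pow_of_xi_pow_mul_mem k m h1
  obtain ⟨L, hL⟩ := IsPrecomplete.prec (IsAdicComplete.toIsPrecomplete (I := Ideal.span {(p : Ainf (p := p) F)})) hcauchy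
  have hxL : x - xi ^ k * L = 0 := by
    refine IsHausdorff.haus (IsAdicComplete.toIsHausdorff (I := Ideal.span {(p : Ainf (p := p) F)})) _ fun n => ?_
    have hn := hL n
    rw [smul_eq_mul, Ideal.mul_top, Ideal.span_singleton_pow] at hn ⊢
    rw [SModEq.zero]
    rw [SModEq.sub_mem] at hn
    have : x - xi ^ k * L = (x - xi ^ k * c n) + xi ^ k * (c n - L) := by ring
    rw [this]
    exact Submodule.add_mem _ (hx' n) (Ideal.mul_mem_left _ _ hn)
  rw [sub_eq_zero] at hxL
  exact Ideal.mem_span_singleton'.2 ⟨L, by rw [hxL, mul_comm]⟩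

/-! ### `[ε^a] − 1 ≡ a·u (mod ξ²)` -/

omit [ValuativeRel F] [TopologicalSpace F] [IsNonarchimedeanLocalField F] [CharZero F] [Fact p.Prime]
  [Fact (¬ IsUnit (p : integerC F))] [IsAdicComplete (Ideal.span {(p : integerC F)}) (integerC F)] in
/-- `y^N − 1 − N(y − 1) ∈ ((y − 1)²)` in any commutative ring. [folklore] -/
theorem pow_sub_one_sub_mul_mem {R : Type*} [CommRing R] (y : R) (N : ℕ) :
    y ^ N - 1 - N * (y - 1) ∈ Ideal.span {(y - 1) ^ 2} := by
  induction N with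
  | zero => rw [pow_zero, sub_self, Nat.cast_zero, zero_mul, sub_zero]; exact Submodule.zero_mem _
  | succ N ih =>
    have h : y ^ (N + 1) - 1 - ((N + 1 : ℕ) : R) * (y - 1) =
        (y ^ N - 1 - N * (y - 1)) + (y - 1) ^ 2 * (Finset.range N).sum (fun i => y ^ i) := by
      have hg := (Commute.one_right y).geom_sum₂_mul N
      simp only [one_pow, mul_one] at hg
      push_cast
      linear_combination (-(y - 1)) * hg
    rw [h]
    exact Submodule.add_mem _ ih (Ideal.mul_mem_right _ _ (Ideal.mem_span_singleton_self _))

/-- `p`-adic approximation of `a ∈ ℤ_p` by naturals: `a = (a mod pᵐ) + pᵐ b`. [folklore] -/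
theorem exists_eq_natCast_add_pow_mul (a : ℤ_[p]) (m : ℕ) :
    ∃ b : ℤ_[p], a = (PadicInt.toZModPow m a).val + (p : ℤ_[p]) ^ m * b := by
  haveI : NeZero (p ^ m) := ⟨pow_ne_zero _ (Fact.out : p.Prime).ne_zero⟩
  have h : a - (PadicInt.toZModPow m a).val ∈ RingHom.ker (PadicInt.toZModPow m : ℤ_[p] →+* ZMod (p ^ m)) := by
    rw [RingHom.mem_ker, map_sub, map_natCast, ZMod.natCast_zmod_val, sub_self]
  rw [PadicInt.ker_toZModPow, Ideal.mem_span_singleton] at h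
  obtain ⟨b, hb⟩ := h
  exact ⟨b, by rw [← hb]; ring⟩

/-- **`[ε^a] − 1 ≡ a·u (mod ξ²𝔸_inf)`** for every `a ∈ ℤ_p` — the key to the Tate twist on
`gr¹ B_dR`: exact for `a ∈ ℕ` (binomial identity), and both sides are `p`-adically continuous in
`a` while `ξ²𝔸_inf` is `p`-adically closed. [cite: FontaineAsterisque223III, Exp. II §1.5.4]
[cite: FontaineOuyang2022, §5.1.2] -/
theorem teichmuller_epsPow_sub_one_sub_mem (a : ℤ_[p]) :
    teichmuller p (epsPow a : PreTilt (integerC F) p) - 1 - zpToAinf a * uAinf ∈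
      Ideal.span {(xi : Ainf (p := p) F) ^ 2} := by
  refine mem_span_xi_pow_of_forall 2 fun m => ?_
  obtain ⟨b, hab⟩ := exists_eq_natCast_add_pow_mul a m
  set N : ℕ := (PadicInt.toZModPow m a).val with hN
  -- `[ε^b] − 1 = ξ w'`
  obtain ⟨w', hw'⟩ := xi_dvd_teichmuller_epsPow_sub_one (F := F) (p := p) b
  -- `(1 + w)^(p^m) − 1 − p^m w = q w²`
  obtain ⟨q, hq⟩ := Ideal.mem_span_singleton'.1
    (pow_sub_one_sub_mul_mem (teichmuller p (epsPow b : PreTilt (integerC F) p)) (p ^ m))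
  -- `[ε]^N − 1 − N u = r u²`
  obtain ⟨r, hr⟩ := Ideal.mem_span_singleton'.1 (pow_sub_one_sub_mul_mem (teichmuller p (eps : PreTilt (integerC F) p)) N)
  -- `u = ξ u'`
  obtain ⟨u', hu'⟩ := xi_dvd_uAinf (F := F) (p := p)
  -- decomposition of `[ε^a]` and of `a`
  have hdec : teichmuller p (epsPow a : PreTilt (integerC F) p) =
      teichmuller p (eps : PreTilt (integerC F) p) ^ N * teichmuller p (epsPow b : PreTilt (integerC F) p) ^ p ^ m := by
    conv_lhs => rw [hab, epsPow_add, epsPow_natCast, epsPow_pow_mul, map_mul, map_pow, map_pow]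
  have hzp : zpToAinf a = (N : Ainf (p := p) F) + (p : Ainf (p := p) F) ^ m * zpToAinf b := by
    conv_lhs => rw [hab, map_add, map_natCast, map_mul, map_pow, map_natCast]
  have e1 : teichmuller p (eps : PreTilt (integerC F) p) ^ N =
      1 + (N : Ainf (p := p) F) * uAinf + r * uAinf ^ 2 := by
    rw [uAinf_def]; linear_combination -hr
  have e2 : teichmuller p (epsPow b : PreTilt (integerC F) p) ^ p ^ m =
      1 + (p : Ainf (p := p) F) ^ m * (teichmuller p (epsPow b : PreTilt (integerC F) p) - 1) +
        q * (teichmuller p (epsPow b : PreTilt (integerC F) p) - 1) ^ 2 := by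
    push_cast at hq; linear_combination -hq
  refine ⟨r * u' ^ 2 + teichmuller p (eps : PreTilt (integerC F) p) ^ N * (q * w' ^ 2),
    teichmuller p (eps : PreTilt (integerC F) p) ^ N * (teichmuller p (epsPow b : PreTilt (integerC F) p) - 1) -
      zpToAinf b * uAinf, ?_⟩
  rw [hdec, hzp, e2]
  linear_combination e1 + r * (uAinf + xi * u') * hu' +
    teichmuller p (eps : PreTilt (integerC F) p) ^ N * q *
      ((teichmuller p (epsPow b : PreTilt (integerC F) p) - 1) + xi * w') * hw'

end Tilt

end Literature.NumberTheory.PAdicHodge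

end
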